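import Literature.NumberTheory.EllipticCurves.Gamma0RankinSelbergUnfolding
import Mathlib.MeasureTheory.Integral.DominatedConvergence
import HarnessLib

/-!
# Rankin–Selberg unfolding on `Γ₀(N)` for signed (complex) periodic integrands

Topic `Literature/NumberTheory/EllipticCurves`; namespace
`Literature.NumberTheory.EllipticCurves.ModularForms`; theorems only (no definition, no named
fact). A sequel to `Gamma0RankinSelbergUnfolding.lean`, which proves the unfolding
`∫_F Φ · Σ_{(c,d)=1, N∣c} w(Im γ_{(c,d)}τ) dμ = 2 ∫_{0 ≤ Re < 1} Φ w(Im) dμ` in `ℝ≥0∞` for a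
`Γ₀(N)`-INVARIANT weight `Φ ≥ 0` — enough for `(f, f)` and Rankin's `Σ |aₙ|² n^{-s}`, but not
for the Rankin–Selberg integrals with *signed* integrands: a cusp form against the product of a
second form and an Eisenstein series with character, `∫ f(τ) \overline{g(τ) E_χ(τ, s)} yᵏ dμ`,
whose unfolded integrand `f ḡ y^{k+s}` is only `T`-periodic, not `Γ₀(N)`-invariant
(Rankin 1939, §4; Shimura 1976, §2; Gross 1987, §4; Iwaniec, *Spectral methods*,
§3.2 (3.13), the "unfolding"). Here, for the tree's fundamental domain
`F = ⋃_q g_q⁻¹ 𝒟ᵒ` of `Γ₀(N)`, a section `v ↦ γ_v ∈ Γ₀(N)` of the bottom-row map on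
`{v = (c, d) : (c, d) = 1, N ∣ c}` (`exists_rowSection`) and the strip `P = {0 ≤ Re ρ < 1}`:

* `lintegral_domain_tsum_comp_smul_eq` — **unfolding in `ℝ≥0∞` for a periodic weight**: for every
  measurable `h : ℍ → ℝ≥0∞` with `h(Tⁿρ) = h(ρ)`,
  `∫⁻_F Σ_v h(γ_v τ) dμ = 2 ∫⁻_P h dμ` (the proof of the invariant case verbatim: Tonelli,
  `σ = γ_v τ`, the strips `Tⁿ P`, the bijection `ℤ × {v} ↔ Γ₀(N)`, and the a.e. count `2`);
* `integral_domain_tsum_comp_smul_eq` — **the signed unfolding**: for every measurable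
  `h : ℍ → ℂ` with `h(Tⁿρ) = h(ρ)` and `∫⁻_P ‖h‖ dμ < ∞`,
  `∫_F Σ'_v h(γ_v τ) dμ = 2 ∫_P h dμ`, together with the absolute convergence
  `Σ_v ∫⁻_F ‖h(γ_v τ)‖ dμ = 2 ∫⁻_P ‖h‖ dμ < ∞` (`tsum_lintegral_domain_enorm_comp_smul_eq`) that
  justifies every interchange (Fubini–Tonelli for `Σ_v ∫_F`, the substitutions `σ = γ_v τ` and
  `σ = Tⁿ ρ`, absolute summability of the resulting double series, and dominated exchange of
  `Σ_{δ ∈ Γ₀(N)}` with `∫_P`).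

With `h(τ) = f(τ) \overline{g(τ)} (Im τ)^{k+s}` (`f ∈ S_k`, `g ∈ M_l`, `E` of weight `k - l`) the
left side is `∫_F f \overline{g E(·, s̄)} yᵏ dμ` once `h(γ_v τ)` is identified with the `v`-th
term by the modularity of `f` and `g` — the user's one-line computation — and the right side is
`2 ∫₀^∞∫₀¹ f ḡ y^{k+s} dx dy/y²`, evaluated by `RankinSelbergStripIntegral`.

## References

* R. A. Rankin, *Contributions to the theory of Ramanujan's function τ(n) and similar arithmetical
  functions II*, Proc. Cambridge Philos. Soc. 35 (1939), 357–372, §4.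
* G. Shimura, *The special values of the zeta functions associated with cusp forms*, Comm. Pure
  Appl. Math. 29 (1976), 783–804, §2.
* B. H. Gross, *Heights and the special values of L-series*, CMS Conf. Proc. 7 (1987), §4.
* [Iwaniec2002] H. Iwaniec, *Spectral Methods of Automorphic Forms*, GSM 53, §3.2 (3.13).
-/

noncomputable section

open scoped MatrixGroups ModularForm Modular ENNReal NNReal Function
open MeasureTheory Set Filter ModularGroup CongruenceSubgroup
open UpperHalfPlane hiding I

namespace Literature.NumberTheory.EllipticCurves.ModularForms

section SignedUnfolding

variable {N : ℕ}
variable (g : (↥𝒮ℒ ⧸ (Gamma0 N : Subgroup (GL (Fin 2) ℝ)).subgroupOf 𝒮ℒ) → SL(2, ℤ))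
  (hg : ∀ q, (Matrix.SpecialLinearGroup.mapGL ℝ (g q) : GL (Fin 2) ℝ) =
    ((q.out : ↥𝒮ℒ) : GL (Fin 2) ℝ))
variable (γ : {v : Fin 2 → ℤ // IsCoprime (v 0) (v 1) ∧ (N : ℤ) ∣ v 0} → SL(2, ℤ))
  (hγ : ∀ v, (γ v) 1 0 = v.1 0 ∧ (γ v) 1 1 = v.1 1)
variable [Fintype (↥𝒮ℒ ⧸ (Gamma0 N : Subgroup (GL (Fin 2) ℝ)).subgroupOf 𝒮ℒ)]

/-- **Change of variables `σ = s⁻¹ τ` in `ℝ≥0∞`**: for `s ∈ SL(2, ℤ)` and measurable `E ≥ 0`,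
`∫⁻ σ, 1_F(s σ) E(σ) dμ = ∫⁻_{F} E(s⁻¹ τ) dμ(τ)` (invariance of `dμ = dx dy/y²`). [folklore] -/
theorem lintegral_indicator_smul_mul_eq (s : SL(2, ℤ)) (E : ℍ → ℝ≥0∞) :
    ∫⁻ σ, (⋃ q, {τ : ℍ | g q • τ ∈ 𝒟ᵒ}).indicator (fun _ ↦ (1 : ℝ≥0∞)) (s • σ) * E σ =
      ∫⁻ τ in ⋃ q, {τ : ℍ | g q • τ ∈ 𝒟ᵒ}, E (s⁻¹ • τ) := by
  set F : Set ℍ := ⋃ q, {τ : ℍ | g q • τ ∈ 𝒟ᵒ} with hFdef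
  have hF : MeasurableSet F := measurableSet_domain g
  have e1 : ∫⁻ τ in F, E (s⁻¹ • τ) =
      ∫⁻ τ, F.indicator (fun _ ↦ (1 : ℝ≥0∞)) (s • s⁻¹ • τ) * E (s⁻¹ • τ) := by
    rw [← lintegral_indicator hF]
    refine lintegral_congr fun τ ↦ ?_
    rw [smul_inv_smul]
    by_cases hτ : τ ∈ F
    · rw [indicator_of_mem hτ, indicator_of_mem hτ, one_mul]
    · rw [indicator_of_notMem hτ, indicator_of_notMem hτ, zero_mul]
  rw [e1]
  exact ((measurePreserving_smul (Matrix.SpecialLinearGroup.mapGL ℝ s⁻¹ : GL (Fin 2) ℝ)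
    (volume : Measure ℍ)).lintegral_comp_emb
    (measurableEmbedding_const_smul (Matrix.SpecialLinearGroup.mapGL ℝ s⁻¹ : GL (Fin 2) ℝ))
    (fun σ ↦ F.indicator (fun _ ↦ (1 : ℝ≥0∞)) (s • σ) * E σ)).symm

include hg hγ in
/-- **Rankin–Selberg unfolding on `Γ₀(N)` in `ℝ≥0∞` for a periodic weight**: for measurable
`h : ℍ → ℝ≥0∞` with `h(Tⁿ ρ) = h(ρ)` (`n ∈ ℤ`),
`∫⁻_F Σ_{(c,d)=1, N∣c} h(γ_{(c,d)} τ) dμ = 2 ∫⁻_{0 ≤ Re < 1} h dμ`, `F = ⋃_q g_q⁻¹ 𝒟ᵒ` the tree's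
fundamental domain of `Γ₀(N)` and `v ↦ γ_v` any section of the bottom-row map. The proof is that
of the `Γ₀(N)`-invariant case (`lintegral_domain_mul_tsum_eq`) word for word: Tonelli; `σ = γ_v τ`;
`ℍ = ⨆ₙ Tⁿ{0 ≤ Re < 1}` pulled back by `Tⁿ` (periodicity of `h`); re-indexing by the bijection
`(n, v) ↦ Tⁿ γ_v` onto `Γ₀(N)`; the a.e. count `2` (Rankin 1939; Iwaniec §3.2 (3.13)). [folklore] -/
theorem lintegral_domain_tsum_comp_smul_eq [NeZero N] (h : ℍ → ℝ≥0∞) (hhm : Measurable h)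
    (hT : ∀ (n : ℤ) (ρ : ℍ), h (T ^ n • ρ) = h ρ) :
    ∫⁻ τ in ⋃ q, {τ : ℍ | g q • τ ∈ 𝒟ᵒ}, ∑' v, h (γ v • τ) =
      2 * ∫⁻ ρ in {ρ : ℍ | 0 ≤ ρ.re ∧ ρ.re < 1}, h ρ := by
  haveI : Countable SL(2, ℤ) := countable_SL2Z
  set F : Set ℍ := ⋃ q, {τ : ℍ | g q • τ ∈ 𝒟ᵒ} with hFdef
  set P : Set ℍ := {ρ : ℍ | 0 ≤ ρ.re ∧ ρ.re < 1} with hPdef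
  have hF : MeasurableSet F := measurableSet_domain g
  have hP : MeasurableSet P :=
    (measurableSet_le measurable_const continuous_re.measurable).inter
      (measurableSet_lt continuous_re.measurable measurable_const)
  have hsm : ∀ s : SL(2, ℤ), Measurable fun τ : ℍ ↦ s • τ :=
    fun s ↦ (continuous_sl2z_smul s).measurable
  -- Step 1: sum out
  have step1 : ∫⁻ τ in F, ∑' v, h (γ v • τ) = ∑' v, ∫⁻ τ in F, h (γ v • τ) :=
    lintegral_tsum fun v ↦ (hhm.comp (hsm _)).aemeasurable
  -- Step 2: change of variables `σ = γ_v τ`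
  have step2 : ∀ v, ∫⁻ τ in F, h (γ v • τ) =
      ∫⁻ σ, F.indicator (fun _ ↦ (1 : ℝ≥0∞)) ((γ v)⁻¹ • σ) * h σ := by
    intro v
    rw [lintegral_indicator_smul_mul_eq g (γ v)⁻¹ h, inv_inv]
  -- Step 3: cut `ℍ` into the strips `T^n P` and move each back to `P`
  have step3 : ∀ s : SL(2, ℤ), ∫⁻ σ, F.indicator (fun _ ↦ (1 : ℝ≥0∞)) (s • σ) * h σ =
      ∑' n : ℤ, ∫⁻ ρ in P, F.indicator (fun _ ↦ (1 : ℝ≥0∞)) (s • T ^ n • ρ) * h ρ := by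
    intro s
    rw [← setLIntegral_univ, ← iUnion_strip_eq_univ, lintegral_iUnion measurableSet_strip
      pairwise_disjoint_strip]
    refine tsum_congr fun n ↦ ?_
    rw [← (measurePreserving_smul (Matrix.SpecialLinearGroup.mapGL ℝ (T ^ n) : GL (Fin 2) ℝ)
      (volume : Measure ℍ)).setLIntegral_comp_preimage_emb
      (measurableEmbedding_const_smul (Matrix.SpecialLinearGroup.mapGL ℝ (T ^ n) : GL (Fin 2) ℝ))
      (fun σ ↦ F.indicator (fun _ ↦ (1 : ℝ≥0∞)) (s • σ) * h σ)
      {σ : ℍ | (n : ℝ) ≤ σ.re ∧ σ.re < n + 1}]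
    change ∫⁻ ρ in (fun ρ : ℍ ↦ T ^ n • ρ) ⁻¹' {σ : ℍ | (n : ℝ) ≤ σ.re ∧ σ.re < n + 1},
      F.indicator (fun _ ↦ (1 : ℝ≥0∞)) (s • T ^ n • ρ) * h (T ^ n • ρ) = _
    rw [preimage_T_zpow_strip n]
    refine setLIntegral_congr_fun hP fun ρ _ ↦ ?_
    rw [hT n ρ]
  -- Step 4: reassemble the sums inside the integral over `P`
  have hIm : ∀ (v) (n : ℤ), Measurable fun ρ : ℍ ↦
      F.indicator (fun _ ↦ (1 : ℝ≥0∞)) ((γ v)⁻¹ • T ^ n • ρ) * h ρ :=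
    fun v n ↦ ((measurable_const.indicator hF).comp ((hsm _).comp (hsm _))).mul hhm
  have step4 : ∑' v, ∑' n : ℤ, ∫⁻ ρ in P,
        F.indicator (fun _ ↦ (1 : ℝ≥0∞)) ((γ v)⁻¹ • T ^ n • ρ) * h ρ =
      ∫⁻ ρ in P, (∑' v, ∑' n : ℤ,
        F.indicator (fun _ ↦ (1 : ℝ≥0∞)) ((γ v)⁻¹ • T ^ n • ρ)) * h ρ := by
    symm
    calc ∫⁻ ρ in P, (∑' v, ∑' n : ℤ, F.indicator (fun _ ↦ (1 : ℝ≥0∞)) ((γ v)⁻¹ • T ^ n • ρ)) * h ρ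
        = ∫⁻ ρ in P, ∑' v, ∑' n : ℤ,
            F.indicator (fun _ ↦ (1 : ℝ≥0∞)) ((γ v)⁻¹ • T ^ n • ρ) * h ρ := by
          refine lintegral_congr fun ρ ↦ ?_
          rw [← ENNReal.tsum_mul_right]
          exact tsum_congr fun v ↦ by rw [← ENNReal.tsum_mul_right]
      _ = ∑' v, ∫⁻ ρ in P, ∑' n : ℤ, F.indicator (fun _ ↦ (1 : ℝ≥0∞)) ((γ v)⁻¹ • T ^ n • ρ) * h ρ :=
          lintegral_tsum fun v ↦ (Measurable.tsum fun n ↦ hIm v n).aemeasurable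
      _ = ∑' v, ∑' n : ℤ, ∫⁻ ρ in P, F.indicator (fun _ ↦ (1 : ℝ≥0∞)) ((γ v)⁻¹ • T ^ n • ρ) * h ρ :=
          tsum_congr fun v ↦ lintegral_tsum fun n ↦ (hIm v n).aemeasurable
  -- Step 5: the double sum is the sum over `Γ₀(N)`
  have step5 : ∀ ρ : ℍ, ∑' v, ∑' n : ℤ, F.indicator (fun _ ↦ (1 : ℝ≥0∞)) ((γ v)⁻¹ • T ^ n • ρ) =
      ∑' δ : Gamma0 N, F.indicator (fun _ ↦ (1 : ℝ≥0∞)) ((δ : SL(2, ℤ)) • ρ) := by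
    intro ρ
    set e₁ := Equiv.ofBijective _ (bijective_T_zpow_mul_rowSection γ hγ) with he₁
    have e2 : ∑' δ : Gamma0 N, F.indicator (fun _ ↦ (1 : ℝ≥0∞)) ((δ : SL(2, ℤ)) • ρ) =
        ∑' δ : Gamma0 N, F.indicator (fun _ ↦ (1 : ℝ≥0∞)) (((δ⁻¹ : Gamma0 N) : SL(2, ℤ)) • ρ) :=
      ((Equiv.inv (Gamma0 N)).tsum_eq
        (fun δ : Gamma0 N ↦ F.indicator (fun _ ↦ (1 : ℝ≥0∞)) ((δ : SL(2, ℤ)) • ρ))).symm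
    have e3 : ∑' δ : Gamma0 N,
        F.indicator (fun _ ↦ (1 : ℝ≥0∞)) (((δ⁻¹ : Gamma0 N) : SL(2, ℤ)) • ρ) =
        ∑' p : ℤ × {v : Fin 2 → ℤ // IsCoprime (v 0) (v 1) ∧ (N : ℤ) ∣ v 0},
          F.indicator (fun _ ↦ (1 : ℝ≥0∞)) ((T ^ p.1 * γ p.2)⁻¹ • ρ) := by
      rw [← e₁.tsum_eq]
      rfl
    rw [e2, e3]
    conv_rhs => rw [ENNReal.tsum_prod', ENNReal.tsum_comm]
    refine tsum_congr fun v ↦ ?_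
    conv_rhs => rw [← (Equiv.neg ℤ).tsum_eq]
    refine tsum_congr fun n ↦ ?_
    simp only [Equiv.neg_apply, zpow_neg, mul_inv_rev, inv_inv, mul_smul]
  -- Step 6: which is `2` almost everywhere
  have step6 : ∫⁻ ρ in P, (∑' v, ∑' n : ℤ,
        F.indicator (fun _ ↦ (1 : ℝ≥0∞)) ((γ v)⁻¹ • T ^ n • ρ)) * h ρ = ∫⁻ ρ in P, 2 * h ρ := by
    refine setLIntegral_congr_fun_ae hP ?_
    filter_upwards [tsum_indicator_domain_smul_ae g hg] with ρ hρ _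
    rw [step5 ρ, hρ]
  -- assemble
  rw [step1]
  simp_rw [step2, step3]
  rw [step4, step6, lintegral_const_mul _ hhm]

include hg hγ in
/-- **Absolute convergence of the unfolded sum**: for measurable `h : ℍ → ℂ` with
`h(Tⁿ ρ) = h(ρ)`, `Σ_v ∫⁻_F ‖h(γ_v τ)‖ dμ = 2 ∫⁻_{0 ≤ Re < 1} ‖h‖ dμ` (the periodic unfolding
applied to `‖h‖`). [folklore] -/
theorem tsum_lintegral_domain_enorm_comp_smul_eq [NeZero N] (h : ℍ → ℂ) (hhm : Measurable h)
    (hT : ∀ (n : ℤ) (ρ : ℍ), h (T ^ n • ρ) = h ρ) :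
    ∑' v, ∫⁻ τ in ⋃ q, {τ : ℍ | g q • τ ∈ 𝒟ᵒ}, ‖h (γ v • τ)‖ₑ =
      2 * ∫⁻ ρ in {ρ : ℍ | 0 ≤ ρ.re ∧ ρ.re < 1}, ‖h ρ‖ₑ := by
  haveI : Countable SL(2, ℤ) := countable_SL2Z
  have hsm : ∀ s : SL(2, ℤ), Measurable fun τ : ℍ ↦ s • τ :=
    fun s ↦ (continuous_sl2z_smul s).measurable
  rw [← lintegral_domain_tsum_comp_smul_eq g hg γ hγ (fun τ ↦ ‖h τ‖ₑ) hhm.enorm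
    (fun n ρ ↦ by simp only [hT n ρ])]
  exact (lintegral_tsum fun v ↦ (hhm.enorm.comp (hsm _)).aemeasurable).symm

/-- An `ℝ≥0∞`-valued count of `2` is a complex count of `2`: if `Σ' 1_A = 2` in `ℝ≥0∞` then
`Σ' 1_A = 2` in `ℂ` (`A` has exactly two elements). [folklore] -/
theorem tsum_indicator_one_complex_eq_two {ι : Type*} (A : Set ι)
    (hA : ∑' i, A.indicator (fun _ ↦ (1 : ℝ≥0∞)) i = 2) :
    ∑' i, A.indicator (fun _ ↦ (1 : ℂ)) i = 2 := by
  classical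
  have h1 : (A.encard : ℝ≥0∞) = 2 := by
    rw [← ENNReal.tsum_set_one, tsum_subtype A (fun _ ↦ (1 : ℝ≥0∞))]
    exact hA
  have henc : A.encard = 2 := by exact_mod_cast h1
  obtain ⟨x, y, hxy, rfl⟩ := Set.encard_eq_two.mp henc
  rw [tsum_eq_sum (s := {x, y}) fun i hi ↦ ?_, Finset.sum_pair hxy]
  · simp [hxy]
    norm_num
  · rw [indicator_of_notMem]
    simpa using hi

include hg hγ in
/-- **Rankin–Selberg unfolding on `Γ₀(N)` for a signed periodic integrand.** For measurable
`h : ℍ → ℂ` with `h(Tⁿ ρ) = h(ρ)` (`n ∈ ℤ`) and `∫⁻_{0 ≤ Re < 1} ‖h‖ dμ < ∞`,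
`∫_F Σ'_{(c,d)=1, N∣c} h(γ_{(c,d)} τ) dμ = 2 ∫_{0 ≤ Re ρ < 1} h(ρ) dμ`, `F = ⋃_q g_q⁻¹ 𝒟ᵒ`,
`v ↦ γ_v` any section of the bottom-row map (Rankin 1939, §4; Shimura 1976, §2; Gross 1987,
§4; Iwaniec §3.2 (3.13)). The same six steps as in `ℝ≥0∞`, each interchange justified by the
absolute convergence `tsum_lintegral_domain_enorm_comp_smul_eq`. [folklore] -/
theorem integral_domain_tsum_comp_smul_eq [NeZero N] (h : ℍ → ℂ) (hhm : Measurable h)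
    (hT : ∀ (n : ℤ) (ρ : ℍ), h (T ^ n • ρ) = h ρ)
    (hfin : ∫⁻ ρ in {ρ : ℍ | 0 ≤ ρ.re ∧ ρ.re < 1}, ‖h ρ‖ₑ < ∞) :
    ∫ τ in ⋃ q, {τ : ℍ | g q • τ ∈ 𝒟ᵒ}, ∑' v, h (γ v • τ) =
      2 * ∫ ρ in {ρ : ℍ | 0 ≤ ρ.re ∧ ρ.re < 1}, h ρ := by
  classical
  haveI : Countable SL(2, ℤ) := countable_SL2Z
  set F : Set ℍ := ⋃ q, {τ : ℍ | g q • τ ∈ 𝒟ᵒ} with hFdef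
  set P : Set ℍ := {ρ : ℍ | 0 ≤ ρ.re ∧ ρ.re < 1} with hPdef
  have hF : MeasurableSet F := measurableSet_domain g
  have hP : MeasurableSet P :=
    (measurableSet_le measurable_const continuous_re.measurable).inter
      (measurableSet_lt continuous_re.measurable measurable_const)
  have hsm : ∀ s : SL(2, ℤ), Measurable fun τ : ℍ ↦ s • τ :=
    fun s ↦ (continuous_sl2z_smul s).measurable
  -- the kernel `K s σ = 1_F(s σ)` (complex-valued) and its `ℝ≥0∞` twin
  set K : SL(2, ℤ) → ℍ → ℂ := fun s σ ↦ F.indicator (fun _ ↦ (1 : ℂ)) (s • σ) with hKdef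
  set K' : SL(2, ℤ) → ℍ → ℝ≥0∞ := fun s σ ↦ F.indicator (fun _ ↦ (1 : ℝ≥0∞)) (s • σ) with hK'def
  have hKm : ∀ s, Measurable (K s) := fun s ↦ (measurable_const.indicator hF).comp (hsm s)
  have hK'm : ∀ s, Measurable (K' s) := fun s ↦ (measurable_const.indicator hF).comp (hsm s)
  have hKnorm : ∀ s σ, ‖K s σ * h σ‖ₑ = K' s σ * ‖h σ‖ₑ := by
    intro s σ
    simp only [hKdef, hK'def]
    by_cases hs : s • σ ∈ F
    · rw [indicator_of_mem hs, indicator_of_mem hs, one_mul, one_mul]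
    · rw [indicator_of_notMem hs, indicator_of_notMem hs, zero_mul, zero_mul, enorm_zero]
  -- absolute convergence
  have habs := tsum_lintegral_domain_enorm_comp_smul_eq g hg γ hγ h hhm hT
  have htot : (2 : ℝ≥0∞) * ∫⁻ ρ in P, ‖h ρ‖ₑ < ∞ :=
    ENNReal.mul_lt_top (by simp) hfin
  -- Step 1: sum out (dominated by the absolute convergence)
  have step1 : ∫ τ in F, ∑' v, h (γ v • τ) = ∑' v, ∫ τ in F, h (γ v • τ) := by
    refine integral_tsum (fun v ↦ ((hhm.comp (hsm _)).aestronglyMeasurable)) ?_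
    rw [habs]
    exact htot.ne
  -- Step 2: `σ = γ_v τ`
  have step2 : ∀ v, ∫ τ in F, h (γ v • τ) = ∫ σ, K (γ v)⁻¹ σ * h σ := by
    intro v
    have e1 : ∫ τ in F, h (γ v • τ) = ∫ τ, K (γ v)⁻¹ (γ v • τ) * h (γ v • τ) := by
      rw [← integral_indicator hF]
      refine integral_congr_ae (Eventually.of_forall fun τ ↦ ?_)
      simp only [hKdef, inv_smul_smul]
      by_cases hτ : τ ∈ F
      · rw [indicator_of_mem hτ, indicator_of_mem hτ, one_mul]
      · rw [indicator_of_notMem hτ, indicator_of_notMem hτ, zero_mul]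
    rw [e1]
    exact (measurePreserving_smul (Matrix.SpecialLinearGroup.mapGL ℝ (γ v) : GL (Fin 2) ℝ)
      (volume : Measure ℍ)).integral_comp
      (measurableEmbedding_const_smul (Matrix.SpecialLinearGroup.mapGL ℝ (γ v) : GL (Fin 2) ℝ))
      (fun σ ↦ K (γ v)⁻¹ σ * h σ)
  -- integrability of `K s · h` on `ℍ` for `s = γ_v⁻¹`
  have hlin : ∀ s : SL(2, ℤ), ∫⁻ σ, ‖K s σ * h σ‖ₑ = ∫⁻ τ in F, ‖h (s⁻¹ • τ)‖ₑ := by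
    intro s
    simp_rw [hKnorm]
    exact lintegral_indicator_smul_mul_eq g s (fun σ ↦ ‖h σ‖ₑ)
  have hint : ∀ v, Integrable (fun σ ↦ K (γ v)⁻¹ σ * h σ) := by
    intro v
    refine ⟨((hKm _).mul hhm).aestronglyMeasurable, ?_⟩
    rw [hasFiniteIntegral_iff_enorm, hlin, inv_inv]
    refine lt_of_le_of_lt ?_ (habs ▸ htot)
    exact ENNReal.le_tsum v
  -- Step 3: the strips
  have step3 : ∀ v, ∫ σ, K (γ v)⁻¹ σ * h σ =
      ∑' n : ℤ, ∫ ρ in P, K (γ v)⁻¹ (T ^ n • ρ) * h ρ := by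
    intro v
    rw [← setIntegral_univ, ← iUnion_strip_eq_univ, integral_iUnion measurableSet_strip
      pairwise_disjoint_strip (by rw [iUnion_strip_eq_univ]; exact (hint v).integrableOn)]
    refine tsum_congr fun n ↦ ?_
    rw [← (measurePreserving_smul (Matrix.SpecialLinearGroup.mapGL ℝ (T ^ n) : GL (Fin 2) ℝ)
      (volume : Measure ℍ)).setIntegral_preimage_emb
      (measurableEmbedding_const_smul (Matrix.SpecialLinearGroup.mapGL ℝ (T ^ n) : GL (Fin 2) ℝ))
      (fun σ ↦ K (γ v)⁻¹ σ * h σ) {σ : ℍ | (n : ℝ) ≤ σ.re ∧ σ.re < n + 1}]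
    change ∫ ρ in (fun ρ : ℍ ↦ T ^ n • ρ) ⁻¹' {σ : ℍ | (n : ℝ) ≤ σ.re ∧ σ.re < n + 1},
      K (γ v)⁻¹ (T ^ n • ρ) * h (T ^ n • ρ) = _
    rw [preimage_T_zpow_strip n]
    refine setIntegral_congr_fun hP fun ρ _ ↦ ?_
    rw [hT n ρ]
  -- Step 4/5: re-index the absolutely convergent double series by `δ ∈ Γ₀(N)`
  set e₁ := Equiv.ofBijective _ (bijective_T_zpow_mul_rowSection γ hγ) with he₁
  -- the family over `{v} × ℤ`, the family over `Γ₀(N)` and its `ℝ≥0∞` majorant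
  set Φ : {v : Fin 2 → ℤ // IsCoprime (v 0) (v 1) ∧ (N : ℤ) ∣ v 0} × ℤ → ℂ :=
    fun p ↦ ∫ ρ in P, K (γ p.1)⁻¹ (T ^ p.2 • ρ) * h ρ with hΦdef
  set J : Gamma0 N → ℂ := fun δ ↦ ∫ ρ in P, K (δ : SL(2, ℤ)) ρ * h ρ with hJdef
  set J' : Gamma0 N → ℝ≥0∞ := fun δ ↦ ∫⁻ ρ in P, K' (δ : SL(2, ℤ)) ρ * ‖h ρ‖ₑ with hJ'def
  -- the re-indexing `(v, n) ↦ (T^{-n} γ_v)⁻¹ = γ_v⁻¹ Tⁿ`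
  have hidx : ∀ (v) (n : ℤ) (ρ : ℍ), (γ v)⁻¹ • T ^ n • ρ =
      (((e₁ (-n, v))⁻¹ : Gamma0 N) : SL(2, ℤ)) • ρ := by
    intro v n ρ
    simp only [he₁, Equiv.ofBijective_apply, Subgroup.coe_inv, zpow_neg, mul_inv_rev, inv_inv,
      mul_smul]
  set ε : {v : Fin 2 → ℤ // IsCoprime (v 0) (v 1) ∧ (N : ℤ) ∣ v 0} × ℤ ≃ Gamma0 N :=
    ((Equiv.prodComm _ _).trans ((Equiv.prodCongr (Equiv.neg ℤ) (Equiv.refl _)).trans e₁)).trans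
      (Equiv.inv (Gamma0 N)) with hεdef
  have hε : ∀ p, ((ε p : Gamma0 N) : SL(2, ℤ)) = (((e₁ (-p.2, p.1))⁻¹ : Gamma0 N) : SL(2, ℤ)) := by
    intro p
    simp only [hεdef, Equiv.trans_apply, Equiv.prodComm_apply, Prod.swap, Equiv.prodCongr_apply,
      Prod.map, Equiv.neg_apply, Equiv.refl_apply, Equiv.inv_apply]
  have hΦJ : ∀ p, Φ p = J (ε p) := by
    intro p
    simp only [hΦdef, hJdef, hε]
    refine setIntegral_congr_fun hP fun ρ _ ↦ ?_
    simp only [hKdef, hidx]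
  -- the `ℝ≥0∞` sum over `Γ₀(N)` is `2 ∫⁻_P ‖h‖`
  have hJ'sum : ∑' δ, J' δ = ∫⁻ ρ in P, 2 * ‖h ρ‖ₑ := by
    have hmeas : ∀ δ : Gamma0 N, Measurable fun ρ ↦ K' (δ : SL(2, ℤ)) ρ * ‖h ρ‖ₑ :=
      fun δ ↦ (hK'm _).mul hhm.enorm
    rw [hJ'def]
    rw [← lintegral_tsum fun δ ↦ (hmeas δ).aemeasurable]
    refine setLIntegral_congr_fun_ae hP ?_
    filter_upwards [tsum_indicator_domain_smul_ae g hg] with ρ hρ _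
    rw [ENNReal.tsum_mul_right]
    simp only [hK'def] at hρ ⊢
    rw [hρ]
  have hJ'fin : ∑' δ, J' δ ≠ ∞ := by
    rw [hJ'sum, lintegral_const_mul _ hhm.enorm]
    exact htot.ne
  -- hence the complex family `J` (and `Φ`) is absolutely summable
  have hJle : ∀ δ, ‖J δ‖ ≤ (J' δ).toReal := by
    intro δ
    refine (norm_integral_le_lintegral_norm _).trans (le_of_eq ?_)
    congr 1
    refine lintegral_congr fun ρ ↦ ?_
    rw [ofReal_norm, hKnorm]
  have hJsum : Summable J :=
    Summable.of_norm_bounded (ENNReal.summable_toReal hJ'fin) hJle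
  have hΦsum : Summable Φ := by
    have : Φ = J ∘ ε := funext fun p ↦ hΦJ p
    rw [this]
    exact (ε.summable_iff).mpr hJsum
  have step45 : ∑' v, ∑' n : ℤ, ∫ ρ in P, K (γ v)⁻¹ (T ^ n • ρ) * h ρ = ∑' δ, J δ := by
    calc ∑' v, ∑' n : ℤ, ∫ ρ in P, K (γ v)⁻¹ (T ^ n • ρ) * h ρ
        = ∑' v, ∑' n : ℤ, Φ (v, n) := rfl
      _ = ∑' p, Φ p := hΦsum.tsum_prod.symm
      _ = ∑' p, J (ε p) := tsum_congr hΦJ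
      _ = ∑' δ, J δ := ε.tsum_eq J
  -- Step 6: exchange `Σ_δ` and `∫_P`, and count
  have step6 : ∑' δ, J δ = ∫ ρ in P, 2 * h ρ := by
    have hmeasC : ∀ δ : Gamma0 N, AEStronglyMeasurable (fun ρ ↦ K (δ : SL(2, ℤ)) ρ * h ρ)
        (volume.restrict P) := fun δ ↦ ((hKm _).mul hhm).aestronglyMeasurable
    rw [hJdef, ← integral_tsum hmeasC ?_]
    · refine setIntegral_congr_ae hP ?_
      filter_upwards [tsum_indicator_domain_smul_ae g hg] with ρ hρ _
      rw [tsum_mul_right]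
      congr 1
      have hρ' : ∑' δ : Gamma0 N,
          {δ : Gamma0 N | (δ : SL(2, ℤ)) • ρ ∈ F}.indicator (fun _ ↦ (1 : ℝ≥0∞)) δ = 2 := by
        rw [← hρ]
        refine tsum_congr fun δ ↦ ?_
        simp only [Set.indicator_apply, Set.mem_setOf_eq, hFdef]
      have := tsum_indicator_one_complex_eq_two _ hρ'
      rw [← this]
      refine tsum_congr fun δ ↦ ?_
      simp only [hKdef, Set.indicator_apply, Set.mem_setOf_eq]
    · have : ∀ δ : Gamma0 N, ∫⁻ ρ in P, ‖K (δ : SL(2, ℤ)) ρ * h ρ‖ₑ = J' δ := by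
        intro δ
        simp only [hJ'def]
        exact lintegral_congr fun ρ ↦ hKnorm _ _
      simp_rw [this]
      exact hJ'fin
  -- assemble
  rw [step1]
  simp_rw [step2, step3]
  rw [step45, step6, integral_const_mul]

end SignedUnfolding

end Literature.NumberTheory.EllipticCurves.ModularForms
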